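import Summits.CriticalPhenomena.PercolationContinuityZ3.Theorems.PercNearOneGluingNoHeavyLowerTailCILHyperedgeTools
import HarnessLib

/-!
# `NoHeavyLowerTail` (stmt-CriticalPhenomena-4575) — toolkit for Step 4 of the overtaking bound: the uniform separated-margin identity and the
# degenerate cells (blocks sharing a vertex)

Support file (prover `prim-hp-3`, hull-port line; `--supports stmt-CriticalPhenomena-4575`).  No definitions, no named facts, no sorries.
See run/shared/lean/prim/prim-hp-3/PROOF-OVERTAKING-BOUND.md §7–§9.

* `Hyperedge.sepMargin_eq_closure_sub_uniform` — (L1) with the block event `{1 ≤ |π| ≤ j}`, valid for every block `B ⊆ A` including `∅`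
  (for `B = ∅` both sides are the plain lightness of `i`), so the Step-1 cell needs no case split.
* `Hyperedge.oneBlock_of_twoBlock` — the two-block closure `(R^T)^S` implies the one-block closure `R^{T∪S}` (pointwise, any `R`).
* `Hyperedge.twoBlock_iff_oneBlock_of_meet` — if `T` and `S` share a vertex and `R` is reflexive, the two closures coincide pointwise: such cells need
  no gluing (`overtaking_cell` is for disjoint nonempty blocks).
-/

noncomputable section

namespace Summit.CriticalPhenomena.PercolationContinuityZ3.Theorems

open MeasureTheory Set Literature.Probability.LatticeModels Literature.Probability.Percolation
open scoped Classical BigOperators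

variable {n : ℕ}

namespace Hyperedge

/-- **Separated margin = closure-lightness difference, uniform in the block.**  As `sepMargin_eq_closure_sub` but with the block event
`{1 ≤ |{z : ∃ t ∈ B, R¹ t z}| ≤ j}`, valid for EVERY `B ⊆ A` including `B = ∅` (then both sides are the plain lightness of `i`). [folklore] -/
theorem sepMargin_eq_closure_sub_uniform (u : Sym2 (Fin n) → unitInterval) (A B : Finset (Fin n)) (i : Fin n) (j : ℕ)
    (hBA : B ⊆ A) :
    (prodBernoulli u).real {ω : BondConfig (Fin n) | (∀ y ∈ B, ¬ (openGraph ω).Reachable i y) ∧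
        (A.filter fun z => (openGraph ω).Reachable i z).card ≤ j} -
      (prodBernoulli u).real {ω : BondConfig (Fin n) | (∀ y ∈ B, ¬ (openGraph ω).Reachable i y) ∧
        1 ≤ (A.filter fun z => ∃ y ∈ B, (openGraph ω).Reachable y z).card ∧
        (A.filter fun z => ∃ y ∈ B, (openGraph ω).Reachable y z).card ≤ j} =
    (prodBernoulli u).real {ω : BondConfig (Fin n) |
        (A.filter fun z => (openGraph ω).Reachable i z ∨
          ((∃ t ∈ B, (openGraph ω).Reachable i t) ∧ ∃ t ∈ B, (openGraph ω).Reachable t z)).card ≤ j} -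
      (prodBernoulli u).real {ω : BondConfig (Fin n) |
        1 ≤ (A.filter fun z => ∃ s ∈ B, ((openGraph ω).Reachable s z ∨
          ((∃ t ∈ B, (openGraph ω).Reachable s t) ∧ ∃ t ∈ B, (openGraph ω).Reachable t z))).card ∧
        (A.filter fun z => ∃ s ∈ B, ((openGraph ω).Reachable s z ∨
          ((∃ t ∈ B, (openGraph ω).Reachable s t) ∧ ∃ t ∈ B, (openGraph ω).Reachable t z))).card ≤ j} := by
  set μ := prodBernoulli u with hμ
  set C : Set (BondConfig (Fin n)) := {ω | ∃ y ∈ B, (openGraph ω).Reachable i y} with hC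
  set SepL := {ω : BondConfig (Fin n) | (∀ y ∈ B, ¬ (openGraph ω).Reachable i y) ∧
    (A.filter fun z => (openGraph ω).Reachable i z).card ≤ j} with hSepL
  set SepB := {ω : BondConfig (Fin n) | (∀ y ∈ B, ¬ (openGraph ω).Reachable i y) ∧
    1 ≤ (A.filter fun z => ∃ y ∈ B, (openGraph ω).Reachable y z).card ∧
    (A.filter fun z => ∃ y ∈ B, (openGraph ω).Reachable y z).card ≤ j} with hSepB
  set E1 := {ω : BondConfig (Fin n) |
    (A.filter fun z => (openGraph ω).Reachable i z ∨
      ((∃ t ∈ B, (openGraph ω).Reachable i t) ∧ ∃ t ∈ B, (openGraph ω).Reachable t z)).card ≤ j} with hE1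
  set E2 := {ω : BondConfig (Fin n) |
    1 ≤ (A.filter fun z => ∃ s ∈ B, ((openGraph ω).Reachable s z ∨
      ((∃ t ∈ B, (openGraph ω).Reachable s t) ∧ ∃ t ∈ B, (openGraph ω).Reachable t z))).card ∧
    (A.filter fun z => ∃ s ∈ B, ((openGraph ω).Reachable s z ∨
      ((∃ t ∈ B, (openGraph ω).Reachable s t) ∧ ∃ t ∈ B, (openGraph ω).Reachable t z))).card ≤ j} with hE2
  have hmeas : ∀ S : Set (BondConfig (Fin n)), MeasurableSet S := fun S => (Set.toFinite S).measurableSet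
  -- the block filter is always `{z : B ~ z}`
  have hblock : ∀ ω : BondConfig (Fin n), (A.filter fun z => ∃ s ∈ B, ((openGraph ω).Reachable s z ∨
      ((∃ t ∈ B, (openGraph ω).Reachable s t) ∧ ∃ t ∈ B, (openGraph ω).Reachable t z))) =
      (A.filter fun z => ∃ y ∈ B, (openGraph ω).Reachable y z) := by
    intro ω
    refine Finset.filter_congr fun z _ => ⟨?_, ?_⟩
    · rintro ⟨s, hs, h | ⟨_, ⟨t, ht, htz⟩⟩⟩
      · exact ⟨s, hs, h⟩
      · exact ⟨t, ht, htz⟩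
    · rintro ⟨y, hy, hyz⟩
      exact ⟨y, hy, Or.inl hyz⟩
  -- on C: the filter of `i` is `{z : B ~ z}` as well
  have honC : ∀ ω ∈ C, (A.filter fun z => (openGraph ω).Reachable i z ∨
      ((∃ t ∈ B, (openGraph ω).Reachable i t) ∧ ∃ t ∈ B, (openGraph ω).Reachable t z)) =
      (A.filter fun z => ∃ y ∈ B, (openGraph ω).Reachable y z) := by
    intro ω hω
    obtain ⟨y₀, hy₀, hiy₀⟩ := hω
    refine Finset.filter_congr fun z _ => ⟨?_, ?_⟩
    · rintro (h | ⟨_, ⟨t, ht, htz⟩⟩)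
      · exact ⟨y₀, hy₀, hiy₀.symm.trans h⟩
      · exact ⟨t, ht, htz⟩
    · rintro ⟨y, hy, hyz⟩
      exact Or.inr ⟨⟨y₀, hy₀, hiy₀⟩, ⟨y, hy, hyz⟩⟩
  -- off C: the filter of `i` is the plain one
  have hoffC : ∀ ω : BondConfig (Fin n), ω ∉ C → (A.filter fun z => (openGraph ω).Reachable i z ∨
      ((∃ t ∈ B, (openGraph ω).Reachable i t) ∧ ∃ t ∈ B, (openGraph ω).Reachable t z)) =
      (A.filter fun z => (openGraph ω).Reachable i z) := by
    intro ω hω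
    refine Finset.filter_congr fun z _ => ⟨?_, fun h => Or.inl h⟩
    rintro (h | ⟨hiB, _⟩)
    · exact h
    · exact absurd hiB hω
  -- on C the block is nonempty, hence meets at least one relay (itself)
  have hone : ∀ ω ∈ C, 1 ≤ (A.filter fun z => ∃ y ∈ B, (openGraph ω).Reachable y z).card := by
    intro ω hω
    obtain ⟨b, hb, _⟩ := hω
    exact Finset.card_pos.2 ⟨b, Finset.mem_filter.2 ⟨hBA hb, b, hb, SimpleGraph.Reachable.refl _⟩⟩
  have hnotC : ∀ ω : BondConfig (Fin n), ω ∉ C ↔ ∀ y ∈ B, ¬ (openGraph ω).Reachable i y := by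
    intro ω
    simp only [hC, mem_setOf_eq, not_exists, not_and]
  -- set identities
  have h1C : E1 ∩ C = E2 ∩ C := by
    ext ω
    simp only [mem_inter_iff, hE1, hE2, mem_setOf_eq]
    constructor
    · rintro ⟨h, hω⟩
      rw [honC ω hω] at h
      rw [hblock ω]
      exact ⟨⟨hone ω hω, h⟩, hω⟩
    · rintro ⟨⟨_, h⟩, hω⟩
      rw [hblock ω] at h
      rw [honC ω hω]
      exact ⟨h, hω⟩
  have h1d : E1 \ C = SepL := by
    ext ω
    simp only [mem_sdiff, hE1, hSepL, mem_setOf_eq]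
    constructor
    · rintro ⟨h, hω⟩
      rw [hoffC ω hω] at h
      exact ⟨(hnotC ω).1 hω, h⟩
    · rintro ⟨hsep, h⟩
      have hω : ω ∉ C := (hnotC ω).2 hsep
      rw [hoffC ω hω]
      exact ⟨h, hω⟩
  have h2d : E2 \ C = SepB := by
    ext ω
    simp only [mem_sdiff, hE2, hSepB, mem_setOf_eq]
    constructor
    · rintro ⟨⟨h1, h⟩, hω⟩
      rw [hblock ω] at h1 h
      exact ⟨(hnotC ω).1 hω, h1, h⟩
    · rintro ⟨hsep, h1, h⟩
      rw [hblock ω]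
      exact ⟨⟨h1, h⟩, (hnotC ω).2 hsep⟩
  have s1 := measureReal_inter_add_sdiff₀ (μ := μ) (s := E1) (hmeas C).nullMeasurableSet
  have s2 := measureReal_inter_add_sdiff₀ (μ := μ) (s := E2) (hmeas C).nullMeasurableSet
  rw [h1C, h1d] at s1
  rw [h2d] at s2
  linarith


/-- Two-block closure ⇒ one-block closure (pointwise, any relation). [folklore] -/
theorem oneBlock_of_twoBlock (R : Fin n → Fin n → Prop) (T S : Finset (Fin n)) (a b : Fin n)
    (h : (R a b ∨ ((∃ t ∈ T, R a t) ∧ ∃ t ∈ T, R t b)) ∨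
      ((∃ s ∈ S, R a s ∨ ((∃ t ∈ T, R a t) ∧ ∃ t ∈ T, R t s)) ∧
        ∃ s ∈ S, R s b ∨ ((∃ t ∈ T, R s t) ∧ ∃ t ∈ T, R t b))) :
    R a b ∨ ((∃ t ∈ T ∪ S, R a t) ∧ ∃ t ∈ T ∪ S, R t b) := by
  have hTU : ∀ t ∈ T, t ∈ T ∪ S := fun t ht => Finset.mem_union_left _ ht
  have hSU : ∀ s ∈ S, s ∈ T ∪ S := fun s hs => Finset.mem_union_right _ hs
  rcases h with (h | ⟨⟨c, hc, hac⟩, ⟨c', hc', hcb⟩⟩) | ⟨⟨s, hs, has⟩, ⟨s', hs', hsb⟩⟩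
  · exact Or.inl h
  · exact Or.inr ⟨⟨c, hTU c hc, hac⟩, ⟨c', hTU c' hc', hcb⟩⟩
  · right
    refine ⟨?_, ?_⟩
    · rcases has with h | ⟨⟨c, hc, hac⟩, _⟩
      · exact ⟨s, hSU s hs, h⟩
      · exact ⟨c, hTU c hc, hac⟩
    · rcases hsb with h | ⟨_, ⟨c', hc', hcb⟩⟩
      · exact ⟨s', hSU s' hs', h⟩
      · exact ⟨c', hTU c' hc', hcb⟩

/-- **Blocks sharing a vertex: two-block closure = one-block closure** (pointwise), for `R` reflexive and `v ∈ T ∩ S`. [folklore] -/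
theorem twoBlock_iff_oneBlock_of_meet (R : Fin n → Fin n → Prop) (hrefl : ∀ a, R a a)
    (T S : Finset (Fin n)) {v : Fin n} (hvT : v ∈ T) (hvS : v ∈ S) (a b : Fin n) :
    ((R a b ∨ ((∃ t ∈ T, R a t) ∧ ∃ t ∈ T, R t b)) ∨
      ((∃ s ∈ S, R a s ∨ ((∃ t ∈ T, R a t) ∧ ∃ t ∈ T, R t s)) ∧
        ∃ s ∈ S, R s b ∨ ((∃ t ∈ T, R s t) ∧ ∃ t ∈ T, R t b))) ↔
      (R a b ∨ ((∃ t ∈ T ∪ S, R a t) ∧ ∃ t ∈ T ∪ S, R t b)) := by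
  constructor
  · exact oneBlock_of_twoBlock R T S a b
  · rintro (h | ⟨⟨t₁, ht₁, h₁⟩, ⟨t₂, ht₂, h₂⟩⟩)
    · exact Or.inl (Or.inl h)
    · right
      refine ⟨?_, ?_⟩
      · rcases Finset.mem_union.1 ht₁ with ht₁T | ht₁S
        · exact ⟨v, hvS, Or.inr ⟨⟨t₁, ht₁T, h₁⟩, ⟨v, hvT, hrefl v⟩⟩⟩
        · exact ⟨t₁, ht₁S, Or.inl h₁⟩
      · rcases Finset.mem_union.1 ht₂ with ht₂T | ht₂S
        · exact ⟨v, hvS, Or.inr ⟨⟨v, hvT, hrefl v⟩, ⟨t₂, ht₂T, h₂⟩⟩⟩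
        · exact ⟨t₂, ht₂S, Or.inl h₂⟩

end Hyperedge

end Summit.CriticalPhenomena.PercolationContinuityZ3.Theorems
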